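import Mathlib
import HarnessLib.Audit
import Summits.PneNP.PneNP.Theorems.PstarGapLemma

/-!
# The gap lemma for UNIT PINS holds with the absolute constant 2 (ROUND-24, item T24.20 — statement; proof sketched below)

FRONTIER range-avoidance ladder, rung F-N3, ROUND 24 (cell `pnp-ideate`, planner seat p3; restricted-model proof complexity —
nothing here bears on `P` versus `NP`).

`PstarGapLemma.PstarGapLemmaSO` (the live crux) asks for `|J| ≤ K(Δ)·|W|` for every minimal `W`-infeasible output set `J` of an
expanding typed pure-`P⋆` instance, `W` a set of parity constraints.  This file records the case in which every constraint is a UNIT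
PIN `a_v = c` on a variable that is not an XOR slot of any output: then `|J| ≤ 2·|W|`, with NO degree bound, NO simple-overlap
hypothesis and NO typing beyond "pins avoid XOR slots" (memo ROUND-24-PRESEED §13 R10(z′)).

PROOF SKETCH (four lines; all ingredients are in the tree or in `PstarGSatSteps`).  Let `J ≠ ∅` be minimal infeasible under the pins.
(1) No output `g ∈ J` has a J-private XOR slot `t`: `t` is unpinned (pins avoid XOR slots), so a solution of `(J ∖ g) ∪ W` with `t`
    flipped if necessary solves `J ∪ W` (cf. `PstarGSatSteps.step_xor`).  Hence `bdry I J` consists of J-private AND slots and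
    `#bdry = 2·ch + k₁`, where `ch` (`k₁`) counts the outputs with two (one) J-private AND slots.
(2) Every output `g` with two J-private AND slots holds a pinned variable: otherwise (both slots unpinned, or one pinned to `true` and
    the other unpinned) a solution of `(J ∖ g) ∪ W` extends to `g` by choosing the private slots (`a·a' := x_u ⊕ x_v ⊕ y_g`), so
    `g` would be removable.  Private slots of distinct outputs are distinct variables, so `ch ≤ |W|`.
(3) Boundary expansion `3·|J| ≤ 2·#bdry = 4·ch + 2·k₁` gives `k₁ + 3·oth ≤ ch`, hence `|J| = ch + k₁ + oth ≤ 2·ch ≤ 2·|W|`.  □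
Tightness up to the constant: pins `u₁ = u₂ = u₃ = 0`, `d = 0` and the hexagon `g₁ f₁ g₂ f₂ g₃ f₃` with `g_i = (u_i, p_i; ·,·)`,
`f_i = (d, e_i; ·,·)` and odd closing target is minimal infeasible with `|J| = 6`, `|W| = 4`, boundary `9 = 1.5·6`.
So for pin constraints the crux holds with `K = 2`; the whole difficulty of `PstarGapLemmaSO` is in parities that read XOR tips
(readers, activation, tensor and clause configurations — memo R10(v)–(z)).
-/

set_option linter.dupNamespace false

open Finset Literature.Computability.Complexity
open Summit.PneNP.PneNP.Theorems.PstarSALevel (BoundaryExpanding)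
open Summit.PneNP.PneNP.Theorems.PstarGapLemma (MinInfeasible)

namespace Summit.PneNP.PneNP.Theorems.PstarPinGap

variable {n m : ℕ}

/-- `W` consists of UNIT PINS on variables that are not XOR slots (slots `0,1`) of any output of `I`. -/
def UnitPins (I : LocalMap 4 n m) (W : Finset (Finset (Fin n) × Bool)) : Prop :=
  ∀ e ∈ W, ∃ v : Fin n, e.1 = {v} ∧ ∀ (j : Fin m) (s : Fin 4), s.val < 2 → I.vars j s ≠ v

/-- **T24.20 — the pin gap lemma (statement; expected TRUE with the proof sketched in the module docstring).**  On boundary-expanding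
pure-`P⋆` instances, a minimal infeasible output set under unit pins has at most twice as many outputs as there are pins.  FRONTIER. -/
@[conjecture] def PinGap : Prop :=
  ∀ (n m r : ℕ) (I : LocalMap 4 n m), I.IsPure xorAndPred → BoundaryExpanding r I →
    ∀ (y : Fin m → Bool) (W : Finset (Finset (Fin n) × Bool)) (J : Finset (Fin m)),
      UnitPins I W → J.card ≤ r → MinInfeasible I y W J → J.card ≤ 2 * W.card

/-- The empty constraint set is (vacuously) a set of unit pins. -/
theorem unitPins_empty (I : LocalMap 4 n m) : UnitPins I ∅ := fun e he => absurd he (by simp)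

/-- A single pin on a non-XOR-slot variable is a set of unit pins. -/
theorem unitPins_singleton (I : LocalMap 4 n m) (v : Fin n) (c : Bool)
    (hv : ∀ (j : Fin m) (s : Fin 4), s.val < 2 → I.vars j s ≠ v) : UnitPins I {({v}, c)} := by
  intro e he
  rw [mem_singleton] at he
  subst he
  exact ⟨v, rfl, hv⟩

end Summit.PneNP.PneNP.Theorems.PstarPinGap
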